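import Summits.BirchSwinnertonDyer.BirchSwinnertonDyer.Theorems.PrintX11aLowerHalfOddPrimeStub
import Literature.NumberTheory.EllipticCurves.Wuthrich2014.ThreeAdicImageSupersingularProofs
import HarnessLib

/-!
# Crux `X11aLowerHalf` (item stmt-BirchSwinnertonDyer-19064), line birth r4 — the fact stub `stub_chainFactsLower` has SEVEN open
# conjuncts, not eight: Wuthrich's Lemma 20 is a THEOREM of the tree

Cell `bsd-print-x11a`, width seat bsd-line-x11a-p1-w2 g3 (`--supports stmt-BirchSwinnertonDyer-19064`, helper). One theorem, no
definition, no named fact minted, no `sorry`. BSD is not proved by any of this; nothing about any curve is asserted.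

The registered r4 stub `stub_chainFactsLower` of `Cruxes/X11aLowerHalf/Lines/birth.lean` is the conjunction of EIGHT named published
facts; its last conjunct `Wuthrich2014.lemma20_surjective_threeAdic_of_semistable` (C. Wuthrich, Doc. Math. 19 (2014) Lemma 20:
for `E/ℚ` semistable at `3` with `ρ̄_{E,3}` surjective, `ρ_{E,3^∞}` is surjective) is PROVED in the tree
(`Wuthrich2014.lemma20_surjective_threeAdic_of_semistable_holds`, `Literature/…/Wuthrich2014/ThreeAdicImageSupersingularProofs.lean`,
cell b2b; referee x11a-ref g17 08:44Z: «carry-as-stub is harmless, cheaper to discharge»).  `chainFactsLower_of_seven` supplies the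
registered eight-conjunct statement from the remaining SEVEN facts, so the lead may reshape the stub to seven conjuncts (or keep it and
feed this).  The seven: EPW Thm 3.1.1 / Thm 1 / Thm 5.1.3 at an odd prime (Literature `_odd` instances), X. Wan 2015 Thm 4 rational
part under (irred), Deligne–Serre 6.1, Hida 3.26, Kato–Wuthrich A32 — named Literature facts, untouched here.
References: [Wuthrich2014] Lemma 20 (p. 399); [EmertonPollackWeston2006] Thm. 1, 3.1.1, 5.1.3; [Wan2015] Thm. 4.
-/

set_option linter.dupNamespace false
set_option autoImplicit false

open Literature.NumberTheory.EllipticCurves Literature.NumberTheory.EllipticCurves.ModularForms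
  Literature.NumberTheory.EllipticCurves.Wuthrich2014

namespace Summit.BirchSwinnertonDyer.BirchSwinnertonDyer.Theorems.X11aLowerHalfEvenBranch

/-- **`stub_chainFactsLower` from SEVEN facts**: the eighth conjunct, Wuthrich 2014 Lemma 20 (3-adic surjectivity for curves
semistable at `3`), is the tree theorem `Wuthrich2014.lemma20_surjective_threeAdic_of_semistable_holds`.  CONDITIONAL on the seven
displayed named facts; closes nothing by itself. [cite: Wuthrich2014, Lemma 20 (p. 399)] [cite: EmertonPollackWeston2006, Thm. 5.1.3]
[cite: Wan2015, Thm. 4 (pp. 4–5)] -/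
theorem chainFactsLower_of_seven
    (h311 : EmertonPollackWeston2006.thm311_cotorsion_weightK_member_ofLevel_odd)
    (hT1a : EmertonPollackWeston2006.thm1_muAlg_of_weightK_member_ofLevel_odd)
    (hT2 : Wan2015.thm4_rational_weightK_member_of_bdd_ofLevel_irred)
    (hT1b : EmertonPollackWeston2006.thm513_transfer_from_weightK_member_of_bdd_ofLevel_odd)
    (h61 : ModularForms.DeligneSerre1974.thm61_exists_adicGaloisRep)
    (h326 : Hida2000_thm326_ordinary)
    (hKato : Wuthrich2014.kato_charIdeal_dvd_multiplicative_of_surjective) :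
    EmertonPollackWeston2006.thm311_cotorsion_weightK_member_ofLevel_odd ∧
    EmertonPollackWeston2006.thm1_muAlg_of_weightK_member_ofLevel_odd ∧
    Wan2015.thm4_rational_weightK_member_of_bdd_ofLevel_irred ∧
    EmertonPollackWeston2006.thm513_transfer_from_weightK_member_of_bdd_ofLevel_odd ∧
    ModularForms.DeligneSerre1974.thm61_exists_adicGaloisRep ∧
    Hida2000_thm326_ordinary ∧
    Wuthrich2014.kato_charIdeal_dvd_multiplicative_of_surjective ∧
    Wuthrich2014.lemma20_surjective_threeAdic_of_semistable :=
  ⟨h311, hT1a, hT2, hT1b, h61, h326, hKato, Wuthrich2014.lemma20_surjective_threeAdic_of_semistable_holds⟩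

end Summit.BirchSwinnertonDyer.BirchSwinnertonDyer.Theorems.X11aLowerHalfEvenBranch
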